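import Summits.BirchSwinnertonDyer.BirchSwinnertonDyer.Theorems.SignedBaseChangeK2RTransferDescent
import Summits.BirchSwinnertonDyer.BirchSwinnertonDyer.Theorems.SignedBaseChangeK2RMuZero
import Summits.BirchSwinnertonDyer.BirchSwinnertonDyer.Theorems.SignedBaseChangeK2RDelocalisation
import Literature.NumberTheory.EllipticCurves.BurungaleSkinnerTianWan2024.GreenbergLFunctionSupersingularExistsPRE
import Literature.NumberTheory.EllipticCurves.YanZhu2026.GreenbergMainTheoremsAnyRoot
import HarnessLib

/-!
# K2R⁗ — the descent crux `SignedLowerDescentFromCommonFrame` (stmt-BirchSwinnertonDyer-20213) with its two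
# owed named inputs threaded and «`γ₁` canonical» in the package: PROVED (every stub of skeleton v6 landed)

Route-independent `Theorems` file of the cell `bsd-wall`, seat `bsd-wall-sbc-p2` (prover of the crux K2R‴).

K2R‴ as filed (route `SignedBaseChange` rev 12/13): `thm41 → thm12 → ModularParametrizationSupply →
RealPeriodUnitPlusPeriod → GSF → ∀ (W, p ≥ 5, ClassX7, Surj), ⟨K1′ package, clauses c1–c22⟩ → ∀ ε,
KobayashiLowerDivisibility W p ε`. This seat's skeleton v6 (evidence on the item) reduced it to three
registered stubs and landed them up to BY-NAME inputs the statement does not bind: (S2) `stub_delocalise`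
PROVED (`…K2RDelocalisation`, p525141); (S1) `stub_muZero` = the refereed fact
`BurungaleCastellaSkinner2025.prop422_greenbergAnyRoot_hasUnitContent_minus` (BCS25 Prop 4.2.2, Gr-half at
good reduction; `…K2RMuZero.stub_muZero_of_prop422GreenbergAnyRoot`, p528542); (S3) `stub_transferDescent` =
the claim-tagged PRE binder `BurungaleSkinnerTianWan2024.props118_27_519_exists_signedTwoVariablePackage_supersingular_PRE`
(BSTW Prop. 1.18 / 2.7 / 5.19, typed by seat ty-1, p528812) for the frame's newforms, under the binder's
coordinate clause «`γ₁` canonical» (`…K2RTransferDescent.productLowerDivisibility_of_package`, p531951).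

THIS FILE assembles them: `signedLowerDescent_of_prop422_of_package` proves the statement **K2R⁗** :=
`prop422_greenbergAnyRoot_hasUnitContent_minus → props118_27_519_…_PRE → ⟨K2R‴ VERBATIM (route aliases
spelled by their Literature names), with ONE conjunct appended INSIDE its ∃-package: c23 «γ₁ canonical» =
∃ ζ ∈ ℤ_pˣ of finite order, χ_cyc,K(γ₁)·ζ = cyclotomicGenerator p⟩`. So the route's descent crux holds
modulo exactly: (i) one refereed named fact (Hsieh 2014 Thm B + CGS Prop 2.4.5 as printed in BCS25 Prop
4.2.2), (ii) one PREPRINT binder (BSTW's two-variable signed package), (iii) the clause c23, which is free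
for the ∃K crux K1′ (choose γ₁ with χ_cyc,K(γ₁) = 1 + p) — for the route author's pen (K2R⁗/K1″ restate
after the statement freeze), nothing is edited here.

Proof = skeleton v6's composition bis with (S3) replaced by the landed package consumer, and the packaging
step of `…EisensteinSqueeze.X7.kobayashiMainConjecture_of_productLowerDivisibility` (p518504) re-run with the
frame's own conductor-level newforms `f`, `f'` (after `subst N = N_W, N' = N_{W'}`; Kobayashi's conjecture
binds the conductor-level newform, unique by `IsNewformOf.unique`), Kato's bound ×4 (thm41 + thm12 + Surj),
the four-factor squeeze, and the Néron normalisation (period unit). Nothing of BSTW is asserted.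

References: [BurungaleSkinnerTianWan2024] arXiv:2409.01350v2 §2.3 proof of Thm. (KoMC_r) (corpus
paper:arxiv-2409.01350 p0075–p0076); [Kobayashi2003] Conj. (p. 2), Thm. 1.2, Thm. 4.1; [BurungaleCastellaSkinner2025]
Prop. 4.2.2; cell files HOME/bsd-wall-sbc-p2/K2R-CENSUS-v3.md, SignedLowerDescentFromCommonFrame_Lines_v6_20213.lean.
-/

set_option autoImplicit false

noncomputable section

open scoped Classical MatrixGroups ModularForm

open CongruenceSubgroup WeierstrassCurve NumberField IsDedekindDomain Field
  Literature.NumberTheory.GaloisRepresentations Literature.NumberTheory.EllipticCurves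
  Literature.NumberTheory.EllipticCurves.ModularForms Literature.NumberTheory.EllipticCurves.Rank1Residual
  Literature.NumberTheory.EllipticCurves.BurungaleSkinnerTianWan2024
  Literature.NumberTheory.EllipticCurves.BurungaleCastellaSkinner2025
  Literature.NumberTheory.EllipticCurves.Kobayashi2003 ZpExtension
  Summit.BirchSwinnertonDyer.Rank1Residual.Supersingular
  Summit.BirchSwinnertonDyer.BirchSwinnertonDyer.Theorems.SignedBaseChangeEisensteinSqueeze

namespace Summit.BirchSwinnertonDyer.BirchSwinnertonDyer.Theorems.SignedBaseChangeK2RAssembly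

/-- **K2R⁗, PROVED**: granted BY NAME (i) BCS 2025 Prop. 4.2.2 (Gr-half, good reduction, guarded frame form)
`prop422_greenbergAnyRoot_hasUnitContent_minus` and (ii) the BSTW two-variable signed package binder
`props118_27_519_exists_signedTwoVariablePackage_supersingular_PRE`, the statement of the route's descent
crux K2R‴ (stmt-BirchSwinnertonDyer-20213; route aliases spelled by their Literature names) with the clause
c23 «`γ₁` canonical» appended inside its `∃`-package holds: for `p ≥ 5`, an X7 pair with `ρ̄` onto and the
(canonical) K1′ package, the EISENSTEIN HALF `KobayashiLowerDivisibility W p ε` for both signs.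
[cite: BurungaleSkinnerTianWan2024, §2.3 proof of Thm. (KoMC_r) (arXiv v2 TeX store p0076 L36–L65) (the assembly; the preprint enters only as the OPEN binder (ii))]
[cite: Kobayashi2003, Conjecture (Main Conjecture) (p. 2), Thm. 1.2 (p. 2), Thm. 4.1 (p. 8)]
[cite: BurungaleCastellaSkinner2025, Prop. 4.2.2 (§4.2, p. 9 of arXiv:2405.00270v2)] -/
theorem signedLowerDescent_of_prop422_of_package
    (h422 : prop422_greenbergAnyRoot_hasUnitContent_minus)
    (hpkg : props118_27_519_exists_signedTwoVariablePackage_supersingular_PRE) :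
    Literature.NumberTheory.EllipticCurves.Kobayashi2003.thm41_signedCharIdeal_divisibility → Literature.NumberTheory.EllipticCurves.Kobayashi2003.thm12_signedSelmerDual_finite_torsion → Literature.NumberTheory.EllipticCurves.ModularForms.nonempty_modularParametrizationData → Literature.NumberTheory.EllipticCurves.realPeriodRat_eq_unit_mul_plusPeriod → Literature.NumberTheory.EllipticCurves.BurungaleSkinnerTianWan2024.thm617_exists_commonKatzFrame_isGreenbergLFunctionAnyRoot₂_supersingular_PRE → ∀ (W : WeierstrassCurve ℚ) [W.IsElliptic] [W.IsGloballyMinimal] (p : ℕ) [Fact p.Prime], 5 ≤ p → Literature.NumberTheory.EllipticCurves.Rank1Residual.ClassX7 W p → Literature.NumberTheory.EllipticCurves.Rank1Residual.Surj W p → (∃ (K : Type) (_ : Field K) (_ : NumberField K) (ι : PadicAlgCl p ≃+* ℂ) (v vbar : IsDedekindDomain.HeightOneSpectrum (NumberField.RingOfIntegers K)) (κ₁ κ₂ : Literature.NumberTheory.EllipticCurves.ZpExtension K p) (γ₁ γ₂ : Field.absoluteGaloisGroup K) (_ : Fact (Literature.NumberTheory.EllipticCurves.ZpExtension.IsTopGeneratorPair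 κ₁ κ₂ γ₁ γ₂)) (_ : NeZero (NumberField.discr K).natAbs) (N : ℕ) (_ : NeZero N) (f : CuspForm (CongruenceSubgroup.Gamma0 N) 2) (d : ℤ) (W' : WeierstrassCurve ℚ) (_ : W'.IsElliptic) (_ : W'.IsGloballyMinimal) (C : WeierstrassCurve.VariableChange ℚ) (N' : ℕ) (_ : NeZero N') (f' : CuspForm (CongruenceSubgroup.Gamma0 N') 2), Literature.NumberTheory.EllipticCurves.ModularForms.IsNewformOf W f ∧ (N : ℤ) = W.conductorNorm ℤ ∧ Literature.NumberTheory.EllipticCurves.ModularForms.IsNewformOf W' f' ∧ (N' : ℤ) = W'.conductorNorm ℤ ∧ Squarefree d ∧ 1 < d ∧ (∀ q : ℕ, q.Prime → Literature.NumberTheory.EllipticCurves.BurungaleSkinnerTianWan2024.RamifiedInQuadratic d q → q ≠ p ∧ ¬ q ∣ N ∧ ¬ (q : ℤ) ∣ NumberField.discr K) ∧ C • W' = W.quadraticTwist (d : ℚ) ∧ Literature.NumberTheory.EllipticCurves.IsImaginaryQuadratic K ∧ ((Ideal.span {(p : ℤ)}).primesOver (NumberField.RingOfIntegers K)).ncard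 = 2 ∧ ((p : ℕ) : NumberField.RingOfIntegers K) ∈ v.asIdeal ∧ ((p : ℕ) : NumberField.RingOfIntegers K) ∈ vbar.asIdeal ∧ vbar ≠ v ∧ (∀ (w : NumberField.InfinitePlace K) (k : NumberField.RingOfIntegers K), k ∈ v.asIdeal ↔ ‖ι.symm (w.embedding (k : K))‖ < 1) ∧ IsCoprime (N : ℤ) (NumberField.discr K) ∧ (∀ ℓ : ℕ, ℓ.Prime → ℓ ∣ N → ((Ideal.span {(ℓ : ℤ)}).primesOver (NumberField.RingOfIntegers K)).ncard = 2) ∧ (∀ ℓ : ℕ, ℓ.Prime → (ℓ : ℤ) ∣ d → ((Ideal.span {(ℓ : ℤ)}).primesOver (NumberField.RingOfIntegers K)).ncard = 2) ∧ ((Ideal.span {(2 : ℤ)}).primesOver (NumberField.RingOfIntegers K)).ncard = 2 ∧ (∀ ρ : Literature.NumberTheory.GaloisRepresentations.ModPGaloisRep K (ZMod p) 2, (W.baseChange K).IsTorsionGaloisRep p ρ → Literature.NumberTheory.GaloisRepresentations.FramedRep.IsAbsolutelyIrreducible ρ) ∧ κ₁.IsCyclotomic ∧ κ₂.IsAnticyclotomic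 ∧ (∀ (Ω δ : ℂ) (Ωp : (Literature.NumberTheory.EllipticCurves.unrIntegers p)ˣ) (LK G G' : PowerSeries (PowerSeries (PadicComplexInt p))), Ω ≠ 0 → (δ ^ 2 = (NumberField.discr K : ℂ) ∨ δ ^ 2 = -(NumberField.discr K : ℂ)) → Literature.NumberTheory.EllipticCurves.IsKatzMeasure₂ ι v vbar ∅ κ₁ κ₂ γ₁⁻¹ γ₂⁻¹ 1 Ω δ ((Ωp : Literature.NumberTheory.EllipticCurves.unrIntegers p) : PadicComplex p) LK → Literature.NumberTheory.EllipticCurves.IsGreenbergLFunctionAnyRoot₂ ι v vbar κ₁ κ₂ γ₁⁻¹ γ₂⁻¹ f (NumberField.discr K).natAbs (NumberField.classNumber K) LK G → Literature.NumberTheory.EllipticCurves.IsGreenbergLFunctionAnyRoot₂ ι v vbar κ₁ κ₂ γ₁⁻¹ γ₂⁻¹ f' (NumberField.discr K).natAbs (NumberField.classNumber K) LK G' → ∀ J : ℤ_[p] →+* PadicComplexInt p, (∀ x : ℤ_[p], ((J x : PadicComplexInt p) : PadicComplex p) = ((x : ℚ_[p]) : PadicComplex p)) → ∃ s : PowerSeries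 (PadicComplexInt p), s ≠ 0 ∧ Ideal.span {PowerSeries.map (PowerSeries.C (R := PadicComplexInt p)) s} * ((WeierstrassCurve.XGr₂.charIdeal (W.baseChange K) p κ₁ κ₂ vbar γ₁ γ₂).map (Literature.NumberTheory.EllipticCurves.IwasawaAlgebra₂.toUnr₂ p J) * (WeierstrassCurve.XGr₂.charIdeal (W'.baseChange K) p κ₁ κ₂ vbar γ₁ γ₂).map (Literature.NumberTheory.EllipticCurves.IwasawaAlgebra₂.toUnr₂ p J)) ≤ Ideal.span {G * G'}) ∧ (∃ ζ : ℤ_[p]ˣ, IsOfFinOrder ζ ∧ ((Literature.NumberTheory.GaloisRepresentations.GaloisRep.cyclotomicCharacter K p γ₁ * ζ : ℤ_[p]ˣ) : ℤ_[p]) = (Literature.NumberTheory.EllipticCurves.cyclotomicGenerator p : ℤ_[p]))) → ∀ ε : ℤˣ, Summit.BirchSwinnertonDyer.Rank1Residual.Supersingular.KobayashiLowerDivisibility W p ε := by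
  intro h41 h12 hmodP h5 hGF W _ _ p _ hp5 hX hs hP ε
  obtain ⟨K, iF, iNF, ι, v, vbar, κ₁, κ₂, γ₁, γ₂, iTG, iNZ, N, iN, f, d, W', iE', iM', C, N', iN', f',
    c1, c2, c3, c4, c5, c6, c7, c8, c9, c10, c11, c12, c13, c14, c15, c16, c17, c18, c19, c20, c21, c22, c23⟩ := hP
  -- the auxiliary curves `W₂ ≃ W^{(D_K)}`, `W₄ ≃ W'^{(D_K)}` (P0, landed)
  obtain ⟨W₂, W₄, iE₂, iM₂, iE₄, iM₄, C₂, C₄, hC₂, hC₄, ⟨hg₂, ha₂, hs₂⟩, ⟨hg₃, ha₃, hs₃⟩, ⟨hg₄, ha₄, hs₄⟩⟩ :=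
    Summit.BirchSwinnertonDyer.BirchSwinnertonDyer.Theorems.SignedBaseChangeAuxiliaryCurves.stub_auxiliaryCurves
      W p hp5 hX hs K N d W' C c5 c7 c8 c9 c10
  -- ONE common Katz frame with Greenberg functions of `f`, `f'` (GSF on the pair), a structure map `J`
  have hp2 : p ≠ 2 := by omega
  have hpP : p.Prime := Fact.out
  have hgood : W.HasGoodReductionAtPrime p := hX.1.1
  have hap : W.frobeniusTrace p = 0 := ClassX7.frobeniusTrace_eq_zero_of_five_le W p hp5 hX
  have hpN : ¬ (p : ℤ) ∣ W.conductorNorm ℤ := fun h ↦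
    (W.dvd_conductorNorm_iff_not_hasGoodReductionAtPrime p).mp (by exact_mod_cast h) hgood
  have hpd : ¬ (p : ℤ) ∣ d := fun h ↦ (c7 p hpP (Or.inl h)).1 rfl
  have hp2d : ¬ (p : ℤ) ∣ 2 * d := by
    intro h
    rcases (Nat.prime_iff_prime_int.mp hpP).dvd_or_dvd h with h2 | hd'
    · have : p ∣ 2 := by exact_mod_cast h2
      exact hp2 ((Nat.prime_dvd_prime_iff_eq hpP Nat.prime_two).mp this)
    · exact hpd hd'
  have hpN' : ¬ (p : ℤ) ∣ W'.conductorNorm ℤ := fun h ↦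
    (W'.dvd_conductorNorm_iff_not_hasGoodReductionAtPrime p).mp (by exact_mod_cast h) hg₃
  have hND' : IsCoprime (N' : ℤ) (NumberField.discr K) :=
    Summit.BirchSwinnertonDyer.BirchSwinnertonDyer.Theorems.SignedBaseChangeK2RTransferDescent.isCoprime_conductorNorm_twist_discr
      W W' c8 c2 c4 K c9.1 (fun q hq hr ↦ (c7 q hq hr).2.2) c18 c15
  obtain ⟨Ω, δ, Ωp, LK, G, G', hΩ, hδ, hLK, hG, hG'⟩ :=
    exists_commonKatzFrame_greenberg_pair hGF ι K v vbar κ₁ κ₂ γ₁ γ₂ hp5 c9 c10 c11 c12 c13 c14 c20 c21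
      W W' c1 c3 c2 hpN hap c15 c4 hpN' ha₃ hND'
  obtain ⟨J, hJ⟩ := exists_structureMap_padicInt (p := p)
  -- the package's product inclusion at this frame, up to a cyclotomic `s ≠ 0`
  obtain ⟨s, hs0, hincl⟩ := c22 Ω δ Ωp LK G G' hΩ hδ hLK hG hG' J hJ
  -- (S1) μ = 0 by name, (S2) de-localisation (landed)
  obtain ⟨hμ, hμ'⟩ :=
    Summit.BirchSwinnertonDyer.BirchSwinnertonDyer.Theorems.SignedBaseChangeK2RMuZero.stub_muZero_of_prop422GreenbergAnyRoot
      h422 W p hp5 hX hs K ι v vbar κ₁ κ₂ γ₁ γ₂ N f d W' C N' f'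
      c1 c2 c3 c4 c5 c6 c7 c8 c9 c10 c11 c12 c13 c14 c15 c16 c17 c18 c19 c20 c21 Ω δ Ωp LK G G' hΩ hδ hLK hG hG'
  have hfree :=
    Summit.BirchSwinnertonDyer.BirchSwinnertonDyer.Theorems.SignedBaseChangeK2RDelocalisation.stub_delocalise
      p s G G' _ hs0 hμ hμ' hincl
  -- (S3) the package consumer, for the frame's newforms `f`, `f'`
  have hPLD :=
    Summit.BirchSwinnertonDyer.BirchSwinnertonDyer.Theorems.SignedBaseChangeK2RTransferDescent.productLowerDivisibility_of_package
      hpkg W p hp5 hX hs K ι v vbar κ₁ κ₂ γ₁ γ₂ N f d W' C N' f'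
      c1 c2 c3 c4 c5 c6 c7 c8 c9 c10 c11 c12 c13 c14 c15 c16 c17 c18 c19 c20 c21 Ω δ Ωp LK G G' hΩ hδ hLK hG hG'
      J hJ hfree c23 W₂ W₄ C₂ C₄ hC₂ hC₄ ε
  -- levels = conductors: Kobayashi's conjecture binds the conductor-level newform, which is `f` (uniqueness)
  have hNn : N = W.conductorNorm ℤ := by exact_mod_cast c2
  subst hNn
  -- packaging (the proof of `X7.kobayashiMainConjecture_of_productLowerDivisibility` with `f₃ := f'`)
  refine kobayashiLowerDivisibility_of_mainConjecture ?_
  intro κ γ hκ hγ hγ' _ fK hfK ϖ hϖ Lp Lm hPP D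
  have hfeq : f = fK := c1.unique hfK
  subst hfeq
  haveI hfin : Module.Finite (IwasawaAlgebra p) D.X := h12.moduleFinite hp2 hgood hap hκ hγ D
  have hXt : Module.IsTorsion (IwasawaAlgebra p) D.X := h12.isTorsion hp2 hgood hap hκ hγ D
  refine ⟨hXt, ?_⟩
  obtain ⟨g₁, hg₁⟩ := (charIdeal_isPrincipal_holds p D.X).principal
  have hg₁' : D.charIdeal = Ideal.span {g₁} := hg₁
  -- auxiliary data for `W₂`, `W₄`: newforms (modularity), Pollack pairs, Selmer data, generators; for `W'` use `f'`
  haveI : NeZero (W₂.conductorNorm ℤ) := ⟨(W₂.conductorNorm_pos_holds).ne'⟩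
  haveI : NeZero (W₄.conductorNorm ℤ) := ⟨(W₄.conductorNorm_pos_holds).ne'⟩
  obtain ⟨Dm₂⟩ := hmodP W₂
  obtain ⟨Dm₄⟩ := hmodP W₄
  obtain ⟨Lp₂, Lm₂, hPP₂⟩ :=
    exists_isPollackPair pollack_exists_plusMinusPAdicLFunction_holds hp2 Dm₂.isNewformOf hg₂ ha₂
  obtain ⟨Lp₃, Lm₃, hPP₃⟩ :=
    exists_isPollackPair pollack_exists_plusMinusPAdicLFunction_holds hp2 c3 hg₃ ha₃
  obtain ⟨Lp₄, Lm₄, hPP₄⟩ :=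
    exists_isPollackPair pollack_exists_plusMinusPAdicLFunction_holds hp2 Dm₄.isNewformOf hg₄ ha₄
  obtain ⟨D₂⟩ := nonempty_signedSelmerDualData W₂ κ ε hγ
  obtain ⟨D₃⟩ := nonempty_signedSelmerDualData W' κ ε hγ
  obtain ⟨D₄⟩ := nonempty_signedSelmerDualData W₄ κ ε hγ
  obtain ⟨g₂, hg₂c⟩ := (charIdeal_isPrincipal_holds p D₂.X).principal
  obtain ⟨g₃, hg₃c⟩ := (charIdeal_isPrincipal_holds p D₃.X).principal
  obtain ⟨g₄, hg₄c⟩ := (charIdeal_isPrincipal_holds p D₄.X).principal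
  have hg₂' : D₂.charIdeal = Ideal.span {g₂} := hg₂c
  have hg₃' : D₃.charIdeal = Ideal.span {g₃} := hg₃c
  have hg₄' : D₄.charIdeal = Ideal.span {g₄} := hg₄c
  -- the descent's output at these data
  have hprod := hPLD κ γ hκ hγ hγ' Lp Lm hPP D g₁ hg₁' Dm₂.f Dm₂.isNewformOf Lp₂ Lm₂ hPP₂ D₂ g₂ hg₂'
    Lp₃ Lm₃ hPP₃ D₃ g₃ hg₃' Dm₄.f Dm₄.isNewformOf Lp₄ Lm₄ hPP₄ D₄ g₄ hg₄'
  -- Kobayashi Thm. 4.1 (integral under `Surj`) for each of the four curves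
  have hL20 := Wuthrich2014.lemma20_surjective_threeAdic_of_semistable_holds
  have hK₁ : g₁ ∣ kobayashiL ε Lp Lm :=
    h41.dvd_of_charIdeal_eq_span hp2 hgood hap c1 hκ hγ hγ' (hPP.isSignedPAdicLFunction_kobayashiL ε) D hXt
      (surjective_pow_of_surj_of_good W p hL20 hp2 hgood hs) hg₁'
  haveI : Module.Finite (IwasawaAlgebra p) D₂.X := h12.moduleFinite hp2 hg₂ ha₂ hκ hγ D₂
  haveI : Module.Finite (IwasawaAlgebra p) D₃.X := h12.moduleFinite hp2 hg₃ ha₃ hκ hγ D₃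
  haveI : Module.Finite (IwasawaAlgebra p) D₄.X := h12.moduleFinite hp2 hg₄ ha₄ hκ hγ D₄
  have hK₂ : g₂ ∣ kobayashiL ε Lp₂ Lm₂ :=
    h41.dvd_of_charIdeal_eq_span hp2 hg₂ ha₂ Dm₂.isNewformOf hκ hγ hγ'
      (hPP₂.isSignedPAdicLFunction_kobayashiL ε) D₂ (h12.isTorsion hp2 hg₂ ha₂ hκ hγ D₂)
      (surjective_pow_of_surj_of_good W₂ p hL20 hp2 hg₂ hs₂) hg₂'
  have hK₃ : g₃ ∣ kobayashiL ε Lp₃ Lm₃ :=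
    h41.dvd_of_charIdeal_eq_span hp2 hg₃ ha₃ c3 hκ hγ hγ'
      (hPP₃.isSignedPAdicLFunction_kobayashiL ε) D₃ (h12.isTorsion hp2 hg₃ ha₃ hκ hγ D₃)
      (surjective_pow_of_surj_of_good W' p hL20 hp2 hg₃ hs₃) hg₃'
  have hK₄ : g₄ ∣ kobayashiL ε Lp₄ Lm₄ :=
    h41.dvd_of_charIdeal_eq_span hp2 hg₄ ha₄ Dm₄.isNewformOf hκ hγ hγ'
      (hPP₄.isSignedPAdicLFunction_kobayashiL ε) D₄ (h12.isTorsion hp2 hg₄ ha₄ hκ hγ D₄)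
      (surjective_pow_of_surj_of_good W₄ p hL20 hp2 hg₄ hs₄) hg₄'
  -- squeeze: `(g₁) = (L^ε(f))`
  have hassoc : Associated g₁ (kobayashiL ε Lp Lm) :=
    associated_of_dvd_of_mul4_dvd hK₁ hK₂ hK₃ hK₄ (kobayashiL_ne_zero hPP ε) (kobayashiL_ne_zero hPP₂ ε)
      (kobayashiL_ne_zero hPP₃ ε) (kobayashiL_ne_zero hPP₄ ε) hprod
  have hchar : D.charIdeal = Ideal.span {kobayashiL ε Lp Lm} := by
    rw [hg₁']; exact Ideal.span_singleton_eq_span_singleton.mpr hassoc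
  -- Néron normalisation: `ϖ` is a `p`-adic unit
  set L := kobayashiL ε Lp Lm with hL_def
  have hvϖ : padicValRat p ϖ = 0 :=
    padicValRat_periodRatio_eq_zero_of_five_le h5 W p hp5 hgood (ClassX7.irr W p hp2 hX) f c1 ϖ hϖ
  have hϖ0 : ϖ ≠ 0 := by
    intro hz
    rw [hz, Rat.cast_zero, zero_mul] at hϖ
    exact (IsNewform0.plusPeriod_pos_holds c1.1 c1.coeffField_eq_bot).ne' hϖ.symm
  obtain ⟨u, hu⟩ := exists_units_coe_eq_ratCast hϖ0 hvϖ
  obtain ⟨hspan', hι⟩ := span_C_units_mul_eq u L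
  refine ⟨PowerSeries.C (u : ℤ_[p]) * L, ?_, ?_⟩
  · rw [hchar, hspan']
  · rw [hι, hu]

end Summit.BirchSwinnertonDyer.BirchSwinnertonDyer.Theorems.SignedBaseChangeK2RAssembly

end
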